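import Literature.AlgebraicGeometry.Kloosterman2025.TwoPlanesNormalForm
import Literature.RingTheory.GradedAlgebra.GorensteinDoubleAnnihilator
import Mathlib.RingTheory.MvPolynomial.EulerIdentity
import HarnessLib

/-!
# Kloosterman 2025, §3 for two `k`-planes given by ARBITRARY equations: the intrinsic ideal
# `I(Π) = I_Π + J^F` of a plane in a hypersurface, Proposition 3.9 in every degree, and the common image
# `(J^F : I(Π₁) + I(Π₂))` by Gorenstein duality

R. Kloosterman, *On a conjecture on Hodge loci of linear combinations of linear subvarieties*, Rend. Circ. Mat.
Palermo (2) 74 (2025) = arXiv:2312.12363 [Kloosterman2025] (text read: held copy `paper:arxiv-2312.12363`,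
pp. 5, 7, 9–10).

**What is printed.** Construction 3.1 (p. 7): for a Hodge class `γ` on a smooth `X = V(f) ⊂ ℙ^{2k+1}` of degree
`d`, "`J_{(d−2)(k+1)} ⊂ W` … Let `I(γ)` be the largest ideal of `S` such that `I_{(k+1)(d−2)} = W`" — so the
Jacobian ideal `J` lies in the ideal `I(γ)` of every Hodge class. Example 3.5 (p. 7): "Suppose now that `X`
contains a `k`-dimensional subvariety `Y`, which is a complete intersection in `ℙ^{2k+1}`. Let `g_0,…,g_k` be a
system of homogeneous generators of `I(Y)`. Then there exists `h_0,…,h_k` such that `f = g_0h_0 + ⋯ + g_kh_k`.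
In this case the ideal associated with `[Y]` is `⟨g_0,…,g_k,h_0,…,h_k⟩`." Proposition 3.9 (p. 7): "Let `X` be
a hypersurface of degree at least `d ≥ 2 + 2/k` containing two [`k`-planes] `Π₁, Π₂`. Then the Hodge locus
`NL(Π₁,Π₂)` is smooth in a neighborhood of `X`", with the proof: "The tangent space of `NL(Π₁,Π₂)` has
codimension `h_{I₁∩I₂}(d) = h_{I₁}(d) + h_{I₂}(d) − h_{I₁+I₂}(d)`. The ideals `I₁` and `I₂` are complete
intersection ideals with `k+1` generators of degree `1` and `k+1` generators of degree `d−1` … The ideal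
`I₁+I₂` is a complete intersection ideal with `k+c+1` generators of degree `1` and `k−c+1` generators of degree
`d−1`". §4 (p. 10): "after a coordinate change we may assume that `X = V(f)` with
`f = Σ x_i x_j Q_{ij} + Σ x_i P_i`" (the normal form).

**What the tree already had** (`ExcessTangentDimensionLowerBound.lean`, `TwoPlanesNormalForm.lean`): all of
this for `F` GIVEN in the normal form `twoPlanesForm g h g' Q P`, the two ideals being the presentation ideals
`(gens_j) + (cofactors_j)` (which mention `Q`, `P`), and for planes given by ADAPTED equations `(g, g')`,
`(h, g')` (`g'` cutting out the span `Π₁ + Π₂`).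

**What this file adds** (theorems only; 0 definitions, 0 named facts). Throughout `S = K[x_0,…,x_{2k+1}]` over
any field `K`, a "plane" is given by ANY `k+1` linearly independent linear forms `u = (u_0,…,u_k)`, and
`F ∈ S_d ∩ (u)` is any form with finite-dimensional Jacobian ring (`x_l^N ∈ J^F`; every smooth `X ⊇ Π`).

* §1 **The ideal of a plane class is intrinsic: `(u) + (cofactors) = (u) + J^F`** for EVERY presentation
  `F = Σ u_i g_i` along linearly independent linear forms `u` (`span_sup_span_eq_span_sup_jacobianIdeal`; no
  hypothesis on `F` at all). [`⊇`: Construction 3.1's `J ⊂ I(γ)`; `⊆`: differentiate `F = Σ u_i g_i` along the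
  `k+1` points dual to the `u_i`.] Hence Example 3.5's ideal is `I(Π) = I_Π·S + J^F` — for the Fermat variety
  and a standard linear cycle this is the printed `J^{F,δ} = ⟨x_0 − c x_1, …, x_0^{d−1}, …, x_{n+1}^{d−1}⟩` of
  [cite: DuqueFrancoVillaflor2025Join, Remark 7.1] (tree `HodgeTheory.span_X_pow_colon_fermatLinearCyclePolynomial`).
* §2 For one plane: `I(Π) := (u) + J^F` equals the colon ideal `(J^F : D)` of the transition determinant of any
  homogeneous presentation (`jacobianIdeal_colon_det_eq_span_sup_jacobianIdeal`; Example 3.5 / Villaflor's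
  `P_Z = c·det Jac`), is Artinian Gorenstein of socle degree `(k+1)(d−2)` (Remark 3.2), has the complete-
  intersection Hilbert function `h_{I(Π)}(t) = ciHilbert((d−1)^{k+1})(t)` (proof of Prop. 3.9), and its
  annihilator in `R = S/J^F` is the principal ideal of the class: `(J^F : I(Π)) = (D) + J^F`
  (`jacobianIdeal_colon_span_sup_jacobianIdeal_eq`, Gorenstein duality, tree `GorensteinDoubleAnnihilator`).
* §3 For two planes `Π₁ = V(u)`, `Π₂ = V(v)` in ARBITRARY position, `r := dim_K (⟨u⟩_K ∩ ⟨v⟩_K)` (the number of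
  independent linear forms vanishing on both; `= dim(Π₁ ∩ Π₂) + 1 = k + 1 − c`): adapted equations exist
  (`exists_adapted_linearForms`, the linear algebra behind "after a coordinate change we may assume"), and for
  every `F ∈ S_d ∩ (u) ∩ (v)` with finite-dimensional Jacobian ring:
  `h_{I(Π₁)+I(Π₂)}(t) = ciHilbert((d−1)^r)(t)` (`hilbert_planeIdeals_sup_eq_ciHilbert`),
  **`h_{I(Π₁)∩I(Π₂)}(t) + ciHilbert((d−1)^r)(t) = 2·ciHilbert((d−1)^{k+1})(t)`** for every `t`
  (`hilbert_planeIdeals_inf_add_ciHilbert` — Prop. 3.9's tangent-space count in every degree, at every `X` of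
  the locus, for every pair of planes), `= intdim^d_{2k}(r)` at `t = d` (Movasati's number, [cite: Movasati2016Periods, Thm. 13]).
* §4 **The common image.** In `R = S/J^F` the intersection of the two principal ideals of the classes is the
  annihilator of `I(Π₁) + I(Π₂)`: `((D₁) + J^F) ∩ ((D₂) + J^F) = (J^F : I(Π₁) + I(Π₂))`, and by Macaulay duality
  (`finrank_idealDegree_colon_annIdeal_sub`) `dim (J^F : I(Π₁)+I(Π₂))_b − dim J^F_b = ciHilbert((d−1)^r)(a)` for
  `a + b = (2k+2)(d−2)` (`finrank_colon_planeIdeals_sup_sub`), i.e. by the symmetry of the complete-intersection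
  Hilbert function `= ciHilbert((d−1)^r)(b − (2k+2−r)(d−2))`, and `= 0` below `b = (2k+2−r)(d−2)`
  (`finrank_colon_planeIdeals_sup_sub_eq_window`, `…_eq_zero_of_lt`).

Used by the Hodge-locus census cell (record `og81/FERMAT-PAIRS-ALL-DEGREES-g29.md`, THEOREM 1 (i)–(iii)): at the
Fermat point `J^F = (x_i^{d−1})`, so for any two standard planes `P, P'` the keys `rank α_t = h_k(t)`,
`c_t = 2h_k(t) − h_{m+1}(t)` and `dim J_s = h_{m+1}(s − (2k − m − 1)(d−2))` (there `k` = number of pairs = `k+1`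
here, `m + 1 = r`) are the instances `F = Σ x_i^d` of §2–§4; nothing in this file is specific to Fermat.

HONEST SCOPE. Not formalised: the identifications `T_X NL(γ) = I(γ)_d` (Lemma 3.6) and `[Π]_prim ↔ D`
(Griffiths; Villaflor PCIAC Thm. 1), i.e. the Hodge-theoretic reading; the dimension count of the pair locus in
the proof of Prop. 3.9 (smoothness itself). The number `r` is `dim` of the common LINEAR FORMS; its equality
with `dim(Π₁ ∩ Π₂) + 1` is the duality `dim(L₁ ∩ L₂) = 2(k+1) − dim(L₁ + L₂)` recorded in
`finrank_span_inf_add_finrank_span_sup`.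
-/

open MvPolynomial Module Literature.RingTheory.MvPolynomial

attribute [local instance] MvPolynomial.gradedAlgebra

namespace Literature.AlgebraicGeometry.Kloosterman2025

open Literature.AlgebraicGeometry.Kloosterman2023 Literature.AlgebraicGeometry.HodgeTheory
  Literature.AlgebraicGeometry.Motives.UniversalHypersurface
  Literature.AlgebraicGeometry.DuqueFrancoVillaflor2025 Literature.RingTheory.GradedAlgebra
  Literature.AlgebraicGeometry.Villaflor2022

/-! ## §1. The ideal of a plane class is intrinsic: `(u) + (cofactors) = (u) + J^F` -/

section Intrinsic

variable {K : Type*} [Field K] {n : ℕ}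

/-- A form of degree `0` is a constant. [folklore] -/
private theorem eq_C_coeff_zero_of_isHomogeneous_zero {σ : Type*} {p : MvPolynomial σ K}
    (hp : p.IsHomogeneous 0) : p = C (coeff 0 p) := by
  classical
  ext m
  rw [coeff_C]
  split_ifs with hm
  · rw [hm]
  · refine hp.coeff_eq_zero fun h => hm ?_
    rw [Finsupp.degree_eq_zero_iff] at h
    exact h.symm

/-- The directional derivative `Σ_j v_j ∂_j u` of a LINEAR form `u` is the constant `u(v)` (Euler's identity in
degree one). [folklore] -/
private theorem sum_smul_pderiv_eq_C_eval {u : MvPolynomial (Fin n) K} (hu : u.IsHomogeneous 1)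
    (v : Fin n → K) : ∑ j, v j • pderiv j u = C (eval v u) := by
  -- each partial is a constant
  have hc : ∀ j, pderiv j u = C (coeff 0 (pderiv j u)) := fun j =>
    eq_C_coeff_zero_of_isHomogeneous_zero (by simpa using hu.pderiv (i := j))
  -- Euler: `u = Σ x_j ∂_j u`
  have hE : u = ∑ j, X j * C (coeff 0 (pderiv j u)) := by
    have h := hu.sum_X_mul_pderiv
    rw [one_smul] at h
    conv_lhs => rw [← h]
    exact Finset.sum_congr rfl fun j _ => by rw [← hc j]
  have hev : eval v u = ∑ j, v j * coeff 0 (pderiv j u) := by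
    conv_lhs => rw [hE]
    simp only [map_sum, map_mul, eval_X, eval_C]
  rw [hev, map_sum]
  exact Finset.sum_congr rfl fun j _ => by rw [hc j, smul_eq_C_mul, ← map_mul, coeff_C, if_pos rfl]

/-- **Dual points of independent linear forms**: for linearly independent linear forms `u_i` there are points
`v_l ∈ Kⁿ` with `u_i(v_l) = δ_{il}` (the change of coordinates `exists_algEquiv_X_eq` making the `u_i`
coordinate functions, evaluated at the coordinate points). [folklore] -/
private theorem exists_dual_points {ι : Type*} [Fintype ι] [DecidableEq ι] (u : ι → MvPolynomial (Fin n) K)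
    (hu : ∀ i, (u i).IsHomogeneous 1) (hli : LinearIndependent K u) :
    ∃ v : ι → Fin n → K, ∀ i l, eval (v l) (u i) = if i = l then 1 else 0 := by
  classical
  obtain ⟨φ, e, hφ, -, -⟩ := exists_algEquiv_X_eq u hu hli
  -- the character "evaluate the new coordinates at the `l`-th coordinate point"
  let χ : ι → (MvPolynomial (Fin n) K →ₐ[K] K) := fun l =>
    (aeval (Pi.single (e l) (1 : K))).comp (φ.symm : MvPolynomial (Fin n) K →ₐ[K] MvPolynomial (Fin n) K)
  refine ⟨fun l j => χ l (X j), fun i l => ?_⟩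
  have h1 : eval (fun j => χ l (X j)) (u i) = χ l (u i) := by
    conv_rhs => rw [aeval_unique (χ l)]
    rfl
  rw [h1]
  show aeval (Pi.single (e l) (1 : K)) (φ.symm (u i)) = _
  rw [← hφ i, AlgEquiv.symm_apply_apply, aeval_X]
  by_cases hil : i = l
  · subst hil; rw [if_pos rfl, Pi.single_eq_same]
  · rw [if_neg hil, Pi.single_eq_of_ne (fun h => hil (e.injective h))]

/-- The Jacobian ideal of `Σ_i u_i g_i` lies in `(u) + (g)` (product rule). [folklore; cf. [cite: Kloosterman2025, Construction 3.1]] -/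
private theorem jacobianIdeal_sum_mul_le_span_sup_span {N : ℕ} {ι : Type*} [Fintype ι]
    (u g : ι → MvPolynomial (Fin (N + 1)) K) :
    jacobianIdeal (∑ i, u i * g i) ≤ Ideal.span (Set.range u) ⊔ Ideal.span (Set.range g) := by
  refine Ideal.span_le.mpr ?_
  rintro _ ⟨j, rfl⟩
  show pderiv j (∑ i, u i * g i) ∈ Ideal.span (Set.range u) ⊔ Ideal.span (Set.range g)
  rw [map_sum]
  refine Ideal.sum_mem _ fun i _ => ?_
  rw [Derivation.leibniz]
  exact Ideal.add_mem _ (Ideal.mem_sup_left (Ideal.mul_mem_right _ _ (Ideal.subset_span ⟨i, rfl⟩)))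
    (Ideal.mem_sup_right (Ideal.mul_mem_right _ _ (Ideal.subset_span ⟨i, rfl⟩)))

/-- **The ideal of a plane class is intrinsic.** For linearly independent LINEAR forms `u_i` and arbitrary
cofactors `g_i`: `(u) + (g) = (u) + J^F`, `F = Σ_i u_i g_i`. So Example 3.5's "ideal associated with `[Y]`",
`⟨g_0,…,g_k,h_0,…,h_k⟩` for a `k`-plane `Y = V(g_0,…,g_k) ⊂ X = V(f)`, `f = Σ g_i h_i`, does not depend on the
chosen cofactors and equals `I_Y·S + J^f` (`⊇`: Construction 3.1, "`J_{(d−2)(k+1)} ⊂ W`"; `⊆`: apply the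
derivation `Σ_j v_j ∂_j` for a point `v` dual to `u_l`: it sends `F` into `J^F`, `u_i` to `δ_{il}` and so
`F = Σ u_i g_i` to `g_l` modulo `(u)`). [cite: Kloosterman2025, Example 3.5, Construction 3.1]
[cite: DuqueFrancoVillaflor2025Join, Remark 7.1] -/
theorem span_sup_span_eq_span_sup_jacobianIdeal {N : ℕ} {ι : Type*} [Fintype ι]
    (u g : ι → MvPolynomial (Fin (N + 1)) K) (hu : ∀ i, (u i).IsHomogeneous 1) (hli : LinearIndependent K u) :
    Ideal.span (Set.range u) ⊔ Ideal.span (Set.range g) =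
      Ideal.span (Set.range u) ⊔ jacobianIdeal (∑ i, u i * g i) := by
  classical
  apply le_antisymm
  · refine sup_le le_sup_left (Ideal.span_le.mpr ?_)
    rintro _ ⟨l, rfl⟩
    obtain ⟨v, hv⟩ := exists_dual_points u hu hli
    -- the derivation `D = Σ_j v_{lj} ∂_j`
    let D : Derivation K (MvPolynomial (Fin (N + 1)) K) (MvPolynomial (Fin (N + 1)) K) :=
      ∑ j, v l j • pderiv j
    have hD : ∀ p, D p = ∑ j, v l j • pderiv j p := fun p => by
      show (∑ j, v l j • (pderiv j : Derivation K (MvPolynomial (Fin (N + 1)) K) _)) p = _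
      rw [← Derivation.coeFnAddMonoidHom_apply, map_sum, Finset.sum_apply]
      exact Finset.sum_congr rfl fun j _ => by
        rw [Derivation.coeFnAddMonoidHom_apply, Derivation.smul_apply]
    have hDu : ∀ i, D (u i) = C (if i = l then 1 else 0) := fun i => by
      rw [hD, sum_smul_pderiv_eq_C_eval (hu i), hv]
    -- `D F ∈ J^F`
    have hDF : D (∑ i, u i * g i) ∈ jacobianIdeal (∑ i, u i * g i) := by
      rw [hD]
      refine Ideal.sum_mem _ fun j _ => ?_
      rw [smul_eq_C_mul]
      exact Ideal.mul_mem_left _ _ (Ideal.subset_span ⟨j, rfl⟩)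
    -- `D F = g_l + Σ u_i D(g_i)`
    have hsum : ∑ i, g i * C (if i = l then (1 : K) else 0) = g l := by
      rw [Finset.sum_eq_single l (fun i _ hil => by rw [if_neg hil, map_zero, mul_zero])
        (fun h => absurd (Finset.mem_univ l) h), if_pos rfl, map_one, mul_one]
    have hDF' : D (∑ i, u i * g i) = g l + ∑ i, u i * D (g i) := by
      rw [map_sum]
      simp only [Derivation.leibniz, smul_eq_mul, hDu, Finset.sum_add_distrib]
      rw [hsum]
      exact add_comm _ _
    have hgl : g l = D (∑ i, u i * g i) - ∑ i, u i * D (g i) := by rw [hDF']; ring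
    rw [hgl]
    refine Ideal.sub_mem _ (Ideal.mem_sup_right hDF) (Ideal.mem_sup_left (Ideal.sum_mem _ fun i _ => ?_))
    exact Ideal.mul_mem_right _ _ (Ideal.subset_span ⟨i, rfl⟩)
  · exact sup_le le_sup_left (jacobianIdeal_sum_mul_le_span_sup_span u g)

end Intrinsic

/-! ## §2. One `k`-plane `Π = V(u_0,…,u_k) ⊂ X = V(F) ⊂ ℙ^{2k+1}`: the ideal `I(Π) = (u) + J^F` -/

section OnePlane

variable {K : Type*} [Field K] {k : ℕ}

/-- **Homogeneous cofactors**: a form `F` of degree `d ≥ 1` in the ideal of the linear forms `u_i` is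
`F = Σ u_i g_i` with FORMS `g_i` of degree `d − 1` (Example 3.5: "there exists `h_0,…,h_k` such that
`f = g_0h_0 + ⋯ + g_kh_k`"; take degree-`d` components). [cite: Kloosterman2025, Example 3.5] -/
theorem exists_homogeneous_cofactors {ι : Type*} [Fintype ι] {σ : Type*} (u : ι → MvPolynomial σ K)
    (hu : ∀ i, (u i).IsHomogeneous 1) {F : MvPolynomial σ K} {d : ℕ} (hd : 1 ≤ d) (hF : F.IsHomogeneous d)
    (hFu : F ∈ Ideal.span (Set.range u)) :
    ∃ g : ι → MvPolynomial σ K, (∀ i, (g i).IsHomogeneous (d - 1)) ∧ ∑ i, u i * g i = F := by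
  classical
  obtain ⟨c, hc⟩ := Ideal.mem_span_range_iff_exists_fun.mp hFu
  refine ⟨fun i => homogeneousComponent (d - 1) (c i), fun i => homogeneousComponent_isHomogeneous _ _, ?_⟩
  have h := congrArg (homogeneousComponent d) hc
  rw [homogeneousComponent_of_mem hF, if_pos rfl, map_sum] at h
  rw [← h]
  exact Finset.sum_congr rfl fun i _ => by
    rw [homogeneousComponent_mul_of_isHomogeneous (hu i) hd, mul_comm]

/-- **`I(Π) = (J^F : D)`.** For a `k`-plane `Π = V(u_0,…,u_k)` (linearly independent linear forms) and ANY
homogeneous presentation `F = Σ u_i g_i` (`deg g_i = d − 1 ≥ 1`) of a form with finite-dimensional Jacobian ring,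
the colon ideal of the transition determinant `D = det ∂(g,u)/∂x` (Villaflor's `c·det Jac = [Π]_prim`) is the
INTRINSIC ideal `(u) + J^F`, and `D ∉ J^F` (Example 3.5 with §1; tree `det_ciTransitionMatrix_notMem_and_colon_eq`).
[cite: Kloosterman2025, Example 3.5, Construction 3.1] [cite: Villaflor2022PeriodsCI, Thm. 1] -/
theorem jacobianIdeal_colon_det_eq_span_sup_jacobianIdeal {d : ℕ} (hd : 2 ≤ d)
    (u g : Fin (k + 1) → MvPolynomial (Fin (2 * k + 2)) K) (hu : ∀ i, (u i).IsHomogeneous 1)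
    (hli : LinearIndependent K u) (hg : ∀ i, (g i).IsHomogeneous (d - 1)) {N : ℕ} (hN : 0 < N)
    (hXN : ∀ j, (X j : MvPolynomial (Fin (2 * k + 2)) K) ^ N ∈ jacobianIdeal (∑ i, u i * g i)) :
    (ciTransitionMatrix u g).det ∉ jacobianIdeal (∑ i, u i * g i) ∧
      (jacobianIdeal (∑ i, u i * g i)).colon {(ciTransitionMatrix u g).det} =
        Ideal.span (Set.range u) ⊔ jacobianIdeal (∑ i, u i * g i) := by
  obtain ⟨h1, h2⟩ := det_ciTransitionMatrix_notMem_and_colon_eq (d := d) u g (fun _ => 1) (fun _ => d - 1)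
    hu hg (fun _ => Nat.one_pos) (fun _ => by omega) (fun _ => by omega) hN hXN
  exact ⟨h1, by rw [h2, span_sup_span_eq_span_sup_jacobianIdeal u g hu hli]⟩

/-- **`I(Π) = (u) + J^F` is Artinian Gorenstein of socle degree `(k+1)(d−2)`** (Remark 3.2: "the algebra
`S/I(γ)` is an Artinian Gorenstein algebra of socle degree `(d−2)(k+1)`"), for every `k`-plane `Π = V(u)` and
every form `F ∈ S_d ∩ (u)`, `d ≥ 2`, with finite-dimensional Jacobian ring. [cite: Kloosterman2025, Remark 3.2, Example 3.5] -/
theorem isArtinianGorenstein_span_sup_jacobianIdeal {d : ℕ} (hd : 2 ≤ d)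
    (u : Fin (k + 1) → MvPolynomial (Fin (2 * k + 2)) K) (hu : ∀ i, (u i).IsHomogeneous 1)
    (hli : LinearIndependent K u) {F : MvPolynomial (Fin (2 * k + 2)) K} (hF : F.IsHomogeneous d)
    (hFu : F ∈ Ideal.span (Set.range u)) {N : ℕ} (hN : 0 < N)
    (hXN : ∀ j, (X j : MvPolynomial (Fin (2 * k + 2)) K) ^ N ∈ jacobianIdeal F) :
    IsArtinianGorenstein (Ideal.span (Set.range u) ⊔ jacobianIdeal F) ((k + 1) * (d - 2)) := by
  obtain ⟨g, hg, rfl⟩ := exists_homogeneous_cofactors u hu (by omega) hF hFu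
  rw [← span_sup_span_eq_span_sup_jacobianIdeal u g hu hli]
  exact isArtinianGorenstein_span_sup_span (d := d) u g (fun _ => 1) (fun _ => d - 1) hu hg
    (fun _ => Nat.one_pos) (fun _ => by omega) (fun _ => by omega) hN hXN

/-- `J^F ≤ I(Π)`, so a power of every variable lies in `I(Π) = (u) + J^F`. [cite: Kloosterman2025, Construction 3.1] -/
theorem X_pow_mem_span_sup_jacobianIdeal (u : Fin (k + 1) → MvPolynomial (Fin (2 * k + 2)) K)
    {F : MvPolynomial (Fin (2 * k + 2)) K} {N : ℕ}
    (hXN : ∀ j, (X j : MvPolynomial (Fin (2 * k + 2)) K) ^ N ∈ jacobianIdeal F) (j : Fin (2 * k + 2)) :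
    (X j : MvPolynomial (Fin (2 * k + 2)) K) ^ N ∈ Ideal.span (Set.range u) ⊔ jacobianIdeal F :=
  Ideal.mem_sup_right (hXN j)

/-- **`h_{I(Π)}(t) = ciHilbert((d−1)^{k+1})(t)`** for the intrinsic ideal `I(Π) = (u) + J^F` of a `k`-plane in
a hypersurface with finite-dimensional Jacobian ring (proof of Prop. 3.9: "complete intersection ideals with
`k+1` generators of degree `1` and `k+1` generators of degree `d−1` … `h_{I_1}(d) = h_{I_2}(d) = C(k+d,k) − (k+1)²`"),
in EVERY degree `t`. [cite: Kloosterman2025, Proposition 3.9 (proof)] -/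
theorem hilbert_span_sup_jacobianIdeal_eq_ciHilbert {d : ℕ} (hd : 2 ≤ d)
    (u : Fin (k + 1) → MvPolynomial (Fin (2 * k + 2)) K) (hu : ∀ i, (u i).IsHomogeneous 1)
    (hli : LinearIndependent K u) {F : MvPolynomial (Fin (2 * k + 2)) K} (hF : F.IsHomogeneous d)
    (hFu : F ∈ Ideal.span (Set.range u)) {N : ℕ}
    (hXN : ∀ j, (X j : MvPolynomial (Fin (2 * k + 2)) K) ^ N ∈ jacobianIdeal F) (t : ℕ) :
    finrank K (homogeneousSubmodule (Fin (2 * k + 2)) K t) -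
        finrank K (idealDegree (Ideal.span (Set.range u) ⊔ jacobianIdeal F) t) =
      ciHilbert (List.replicate (k + 1) (d - 1)) t := by
  obtain ⟨g, hg, rfl⟩ := exists_homogeneous_cofactors u hu (by omega) hF hFu
  have hXN' : ∀ j, (X j : MvPolynomial (Fin (2 * k + 2)) K) ^ N ∈
      Ideal.span (Set.range u) ⊔ Ideal.span (Set.range g) := fun j => by
    rw [span_sup_span_eq_span_sup_jacobianIdeal u g hu hli]; exact Ideal.mem_sup_right (hXN j)
  rw [← span_sup_span_eq_span_sup_jacobianIdeal u g hu hli,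
    hilbert_span_sup_span_eq_ciHilbert u g (fun _ => 1) (fun _ => d - 1) hu hg (fun _ => Nat.one_pos)
      (fun _ => by omega) hXN' t, List.ofFn_const, List.ofFn_const, ciHilbert_replicate_one_append]

/-- `I(Π) = (u) + J^F` is a homogeneous ideal. [cite: Kloosterman2025, Construction 3.1] -/
theorem isHomogeneous_span_sup_jacobianIdeal {d : ℕ} (u : Fin (k + 1) → MvPolynomial (Fin (2 * k + 2)) K)
    (hu : ∀ i, (u i).IsHomogeneous 1) {F : MvPolynomial (Fin (2 * k + 2)) K} (hF : F.IsHomogeneous d) :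
    (Ideal.span (Set.range u) ⊔ jacobianIdeal F).IsHomogeneous (homogeneousSubmodule (Fin (2 * k + 2)) K) :=
  (Ideal.homogeneous_span _ _ (by rintro _ ⟨i, rfl⟩; exact ⟨1, hu i⟩)).sup
    (Ideal.homogeneous_span _ _ (by rintro _ ⟨j, rfl⟩; exact ⟨d - 1, hF.pderiv⟩))

/-- **The annihilator of `I(Π)` is the class: `(J^F : I(Π)) = (D) + J^F`**, i.e. in the Jacobian ring
`R = S/J^F` one has `Ann_R(I(Π)/J^F) = D·R` for the transition determinant `D` of any homogeneous presentation
`F = Σ u_i g_i` — Gorenstein duality `(J : (J : D)) = (D) + J` (tree `colon_colon_annIdeal_singleton`,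
Meyer–Smith Lemma I.1.1 / Bruns–Herzog 3.2.15 (c)) applied to `I(Π) = (J^F : D)`. In Kloosterman's words
(proof of Lemma 2.9): "The left kernel of `φ_j` equals `(I_j/I₁∩I₂)_α`", i.e. multiplication by the class
kills exactly `I_j`. [cite: Kloosterman2025, Example 3.5, Lemma 2.9 (proof)] [cite: MeyerSmith2005, Lemma I.1.1] -/
theorem jacobianIdeal_colon_span_sup_jacobianIdeal_eq {d : ℕ} (hd : 2 ≤ d)
    (u g : Fin (k + 1) → MvPolynomial (Fin (2 * k + 2)) K) (hu : ∀ i, (u i).IsHomogeneous 1)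
    (hli : LinearIndependent K u) (hg : ∀ i, (g i).IsHomogeneous (d - 1)) {N : ℕ} (hN : 0 < N)
    (hXN : ∀ j, (X j : MvPolynomial (Fin (2 * k + 2)) K) ^ N ∈ jacobianIdeal (∑ i, u i * g i)) :
    (jacobianIdeal (∑ i, u i * g i)).colon
        ((Ideal.span (Set.range u) ⊔ jacobianIdeal (∑ i, u i * g i) : Ideal (MvPolynomial (Fin (2 * k + 2)) K)) :
          Set (MvPolynomial (Fin (2 * k + 2)) K)) =
      Ideal.span {(ciTransitionMatrix u g).det} ⊔ jacobianIdeal (∑ i, u i * g i) := by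
  have hF : (∑ i, u i * g i).IsHomogeneous d :=
    IsHomogeneous.sum _ _ _ fun i _ => by
      have e : d = 1 + (d - 1) := by omega
      rw [e]; exact (hu i).mul (hg i)
  obtain ⟨ℓ, hℓ, -, hJ⟩ := exists_annIdeal_eq_jacobianIdeal (N₀ := 2 * k + 1) hF hd hN hXN
  rw [← (jacobianIdeal_colon_det_eq_span_sup_jacobianIdeal hd u g hu hli hg hN hXN).2, ← hJ]
  exact colon_colon_annIdeal_singleton hℓ
    (isHomogeneous_det_ciTransitionMatrix (d := d) u g (fun _ => 1) (fun _ => d - 1) hu hg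
      (fun _ => Nat.one_pos) (fun _ => by omega) (fun _ => by omega))

end OnePlane

/-! ## §3. Two `k`-planes in arbitrary position: adapted equations, `h_{I₁+I₂}` and Prop. 3.9 in every degree -/

section Adapted

variable {K : Type*} [Field K] {n : ℕ}

/-- Ideals generated by two sets with the same `K`-span coincide. [folklore] -/
private theorem ideal_span_eq_of_span_eq {S : Type*} [CommRing S] [Algebra K S] {s t : Set S}
    (h : Submodule.span K s = Submodule.span K t) : Ideal.span s = Ideal.span t := by
  have key : ∀ {s t : Set S}, Submodule.span K s ≤ Submodule.span K t → Ideal.span s ≤ Ideal.span t :=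
    fun {s t} hst => Ideal.span_le.mpr fun x hx =>
      (Submodule.span_le_restrictScalars K S t) (hst (Submodule.subset_span hx))
  exact le_antisymm (key h.le) (key h.ge)

/-- The `K`-span of a basis of a subspace, pushed into the ambient space, is the subspace. [folklore] -/
private theorem span_range_val_basis {M : Type*} [AddCommGroup M] [Module K M] {W : Submodule K M}
    {ι : Type*} (b : Basis ι K W) : Submodule.span K (Set.range fun i => (b i : M)) = W := by
  have h : (Set.range fun i => (b i : M)) = W.subtype '' Set.range b := by
    rw [← Set.range_comp]; rfl
  rw [h, Submodule.span_image, b.span_eq, Submodule.map_top, Submodule.range_subtype]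

/-- A basis of a subspace, read in the ambient space, is linearly independent. [folklore] -/
private theorem linearIndependent_val_basis {M : Type*} [AddCommGroup M] [Module K M] {W : Submodule K M}
    {ι : Type*} (b : Basis ι K W) : LinearIndependent K fun i => (b i : M) :=
  b.linearIndependent.map' W.subtype W.ker_subtype

/-- **`dim(L₁ ∩ L₂) + dim(L₁ + L₂) = 2(k+1)`** for the spans `L₁ = ⟨u⟩`, `L₂ = ⟨v⟩` of two families of `k+1`
linearly independent linear forms: the number `r = dim(L₁ ∩ L₂)` of independent common equations of two
`k`-planes in `ℙ^{2k+1}` is `2(k+1) − dim(L₁ + L₂) = dim(Π̂₁ ∩ Π̂₂) = dim(Π₁ ∩ Π₂) + 1 = k + 1 − c`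
(Grassmann's formula). [folklore; cf. [cite: Kloosterman2025, Proposition 3.9 (proof)]] -/
theorem finrank_span_inf_add_finrank_span_sup {M : Type*} [AddCommGroup M] [Module K M] {ι : Type*}
    [Fintype ι] {u v : ι → M} (hlu : LinearIndependent K u) (hlv : LinearIndependent K v) :
    finrank K ↥(Submodule.span K (Set.range u) ⊓ Submodule.span K (Set.range v)) +
        finrank K ↥(Submodule.span K (Set.range u) ⊔ Submodule.span K (Set.range v)) =
      2 * Fintype.card ι := by
  haveI := FiniteDimensional.span_of_finite K (Set.finite_range u)
  haveI := FiniteDimensional.span_of_finite K (Set.finite_range v)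
  have h := Submodule.finrank_sup_add_finrank_inf_eq (Submodule.span K (Set.range u))
    (Submodule.span K (Set.range v))
  rw [finrank_span_eq_card hlu, finrank_span_eq_card hlv] at h
  omega

/-- **Adapted equations of two planes** (the linear algebra behind "after a coordinate change we may assume
that `X = V(f)` with `f = Σ_{i<c, c≤j<2c} x_i x_j Q_{ij} + Σ_{i ≥ k+c+1} x_i P_i`", §4 p. 10, and Remark 5.2):
given ANY two families `u`, `v` of linearly independent linear forms (`Π₁ = V(u)`, `Π₂ = V(v)`), with
`r := dim_K(⟨u⟩ ∩ ⟨v⟩)`, there are linear forms `g = (g_i)_{i<c}`, `h = (h_j)_{j<c}`, `g' = (g'_m)_{m<r}`,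
jointly linearly independent, with `(u) = (g, g')` and `(v) = (h, g')` as ideals and `c + r = #u` — a basis
`g'` of the common forms extended by `g` to a basis of `⟨u⟩` and by `h` to a basis of `⟨v⟩`.
[cite: Kloosterman2025, §4 (p. 10), Remark 5.2] -/
theorem exists_adapted_linearForms {ι : Type*} [Fintype ι] (u v : ι → MvPolynomial (Fin n) K)
    (hu : ∀ i, (u i).IsHomogeneous 1) (hv : ∀ i, (v i).IsHomogeneous 1)
    (hlu : LinearIndependent K u) (hlv : LinearIndependent K v) :
    ∃ (c : ℕ) (gA h : Fin c → MvPolynomial (Fin n) K)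
      (gC : Fin (finrank K ↥(Submodule.span K (Set.range u) ⊓ Submodule.span K (Set.range v))) →
        MvPolynomial (Fin n) K),
      (∀ i, (gA i).IsHomogeneous 1) ∧ (∀ j, (h j).IsHomogeneous 1) ∧ (∀ m, (gC m).IsHomogeneous 1) ∧
      LinearIndependent K (Sum.elim (Sum.elim gA h) gC) ∧
      Ideal.span (Set.range u) = Ideal.span (Set.range gA ∪ Set.range gC) ∧
      Ideal.span (Set.range v) = Ideal.span (Set.range h ∪ Set.range gC) ∧
      c + finrank K ↥(Submodule.span K (Set.range u) ⊓ Submodule.span K (Set.range v)) = Fintype.card ι := by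
  classical
  set W₁ : Submodule K (MvPolynomial (Fin n) K) := Submodule.span K (Set.range u) with hW₁def
  set W₂ : Submodule K (MvPolynomial (Fin n) K) := Submodule.span K (Set.range v) with hW₂def
  set W₀ : Submodule K (MvPolynomial (Fin n) K) := W₁ ⊓ W₂ with hW₀def
  haveI : FiniteDimensional K W₁ := FiniteDimensional.span_of_finite K (Set.finite_range u)
  haveI : FiniteDimensional K W₂ := FiniteDimensional.span_of_finite K (Set.finite_range v)
  haveI : FiniteDimensional K W₀ := Submodule.finiteDimensional_inf_left W₁ W₂
  have hW₁ : finrank K W₁ = Fintype.card ι := finrank_span_eq_card hlu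
  have hW₂ : finrank K W₂ = Fintype.card ι := finrank_span_eq_card hlv
  -- all elements of `W₁`, `W₂` are linear forms
  have hW₁hom : W₁ ≤ homogeneousSubmodule (Fin n) K 1 :=
    Submodule.span_le.mpr (by rintro _ ⟨i, rfl⟩; exact hu i)
  have hW₂hom : W₂ ≤ homogeneousSubmodule (Fin n) K 1 :=
    Submodule.span_le.mpr (by rintro _ ⟨i, rfl⟩; exact hv i)
  -- a common complement of `W₀`
  obtain ⟨Q, hQ⟩ := W₀.exists_isCompl
  set W₁' : Submodule K (MvPolynomial (Fin n) K) := W₁ ⊓ Q with hW₁'def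
  set W₂' : Submodule K (MvPolynomial (Fin n) K) := W₂ ⊓ Q with hW₂'def
  have h01 : W₀ ⊔ W₁' = W₁ := by
    rw [sup_comm, hW₁'def, inf_sup_assoc_of_le Q (inf_le_left : W₀ ≤ W₁), sup_comm, hQ.sup_eq_top, inf_top_eq]
  have h02 : W₀ ⊔ W₂' = W₂ := by
    rw [sup_comm, hW₂'def, inf_sup_assoc_of_le Q (inf_le_right : W₀ ≤ W₂), sup_comm, hQ.sup_eq_top, inf_top_eq]
  have hd1 : W₀ ⊓ W₁' = ⊥ :=
    le_bot_iff.mp ((inf_le_inf_left W₀ inf_le_right).trans hQ.inf_eq_bot.le)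
  have hd2 : W₀ ⊓ W₂' = ⊥ :=
    le_bot_iff.mp ((inf_le_inf_left W₀ inf_le_right).trans hQ.inf_eq_bot.le)
  -- dimensions
  have hdim1 : finrank K W₁' + finrank K W₀ = Fintype.card ι := by
    have h := Submodule.finrank_sup_add_finrank_inf_eq W₀ W₁'
    rw [h01, hd1, finrank_bot, hW₁] at h
    omega
  have hdim2 : finrank K W₂' + finrank K W₀ = Fintype.card ι := by
    have h := Submodule.finrank_sup_add_finrank_inf_eq W₀ W₂'
    rw [h02, hd2, finrank_bot, hW₂] at h
    omega
  set c := finrank K W₁' with hcdef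
  have hc2 : finrank K W₂' = c := by omega
  have hle₁ : W₁' ≤ W₁ := inf_le_left
  have hle₂ : W₂' ≤ W₂ := inf_le_left
  have hle₀₁ : W₀ ≤ W₁ := inf_le_left
  have hle₀₂ : W₀ ≤ W₂ := inf_le_right
  have hle₁Q : W₁' ≤ Q := inf_le_right
  have hle₂Q : W₂' ≤ Q := inf_le_right
  -- bases
  let b₀ := Module.finBasis K W₀
  let b₁ := Module.finBasis K W₁'
  let b₂ := Module.finBasisOfFinrankEq K W₂' hc2
  refine ⟨c, fun i => (b₁ i : MvPolynomial (Fin n) K), fun j => (b₂ j : MvPolynomial (Fin n) K),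
    fun m => (b₀ m : MvPolynomial (Fin n) K), fun i => hW₁hom (hle₁ (b₁ i).2),
    fun j => hW₂hom (hle₂ (b₂ j).2), fun m => hW₁hom (hle₀₁ (b₀ m).2), ?_, ?_, ?_, hdim1⟩
  · -- joint linear independence
    have hs₁ := span_range_val_basis b₁
    have hs₂ := span_range_val_basis b₂
    have hs₀ := span_range_val_basis b₀
    have hAB : LinearIndependent K (Sum.elim (fun i => (b₁ i : MvPolynomial (Fin n) K))
        (fun j => (b₂ j : MvPolynomial (Fin n) K))) := by
      refine (linearIndependent_val_basis b₁).sum_type (linearIndependent_val_basis b₂) ?_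
      rw [hs₁, hs₂, Submodule.disjoint_def]
      intro x hx₁ hx₂
      have hx0 : x ∈ W₀ := ⟨hle₁ hx₁, hle₂ hx₂⟩
      have : x ∈ W₀ ⊓ W₁' := ⟨hx0, hx₁⟩
      rw [hd1] at this
      exact (Submodule.mem_bot K).mp this
    refine hAB.sum_type (linearIndependent_val_basis b₀) ?_
    rw [Set.Sum.elim_range, Submodule.span_union, hs₁, hs₂, hs₀, Submodule.disjoint_def]
    intro x hx hx0
    obtain ⟨a, ha, b, hb, rfl⟩ := Submodule.mem_sup.mp hx
    have hbW₁ : b ∈ W₁ := by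
      have : a + b - a ∈ W₁ := W₁.sub_mem (hle₀₁ hx0) (hle₁ ha)
      simpa using this
    have hb0 : b ∈ W₀ ⊓ W₂' := ⟨⟨hbW₁, hle₂ hb⟩, hb⟩
    rw [hd2, Submodule.mem_bot] at hb0
    subst hb0
    have ha0 : a ∈ W₀ ⊓ W₁' := ⟨by simpa using hx0, ha⟩
    rw [hd1, Submodule.mem_bot] at ha0
    simp [ha0]
  · -- `(u) = (g, g')`
    apply ideal_span_eq_of_span_eq (K := K)
    rw [Submodule.span_union, span_range_val_basis b₁, span_range_val_basis b₀, sup_comm, h01]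
  · -- `(v) = (h, g')`
    apply ideal_span_eq_of_span_eq (K := K)
    rw [Submodule.span_union, span_range_val_basis b₂, span_range_val_basis b₀, sup_comm, h02]

end Adapted

section TwoPlanes

variable {K : Type*} [Field K] {k c r : ℕ}

/-- For ADAPTED equations and `F` in normal form, the presentation ideal of `Π₁` (which mentions the cofactors
`Q`, `P`) is the intrinsic ideal `(g, g') + J^F`. [cite: Kloosterman2025, Example 3.5, §2.2] -/
theorem planes₁_eq_span_sup_jacobianIdeal (κ : Fin c ⊕ Fin r ≃ Fin (k + 1))
    (gA h : Fin c → MvPolynomial (Fin (2 * k + 2)) K) (gC : Fin r → MvPolynomial (Fin (2 * k + 2)) K)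
    (Q : Fin c → Fin c → MvPolynomial (Fin (2 * k + 2)) K) (P : Fin r → MvPolynomial (Fin (2 * k + 2)) K)
    (hgA : ∀ i, (gA i).IsHomogeneous 1) (hgC : ∀ m, (gC m).IsHomogeneous 1)
    (hli : LinearIndependent K (Sum.elim gA gC)) :
    Ideal.span (Set.range (plane₁Gens κ gA gC)) ⊔ Ideal.span (Set.range (plane₁Cofs κ h Q P)) =
      Ideal.span (Set.range gA ∪ Set.range gC) ⊔ jacobianIdeal (twoPlanesForm gA h gC Q P) := by
  have hrange : Set.range (plane₁Gens κ gA gC) = Set.range gA ∪ Set.range gC := by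
    rw [show plane₁Gens κ gA gC = Sum.elim gA gC ∘ κ.symm from rfl, κ.symm.surjective.range_comp,
      Set.Sum.elim_range]
  rw [span_sup_span_eq_span_sup_jacobianIdeal (plane₁Gens κ gA gC) (plane₁Cofs κ h Q P)
    (isHomogeneous_plane₁Gens κ hgA hgC) (hli.comp κ.symm κ.symm.injective),
    sum_plane₁Gens_mul_plane₁Cofs, hrange]

/-- … and the same for `Π₂`: `(gens₂) + (cofs₂) = (h, g') + J^F`. [cite: Kloosterman2025, Example 3.5, §2.2] -/
theorem planes₂_eq_span_sup_jacobianIdeal (κ : Fin c ⊕ Fin r ≃ Fin (k + 1))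
    (gA h : Fin c → MvPolynomial (Fin (2 * k + 2)) K) (gC : Fin r → MvPolynomial (Fin (2 * k + 2)) K)
    (Q : Fin c → Fin c → MvPolynomial (Fin (2 * k + 2)) K) (P : Fin r → MvPolynomial (Fin (2 * k + 2)) K)
    (hh : ∀ j, (h j).IsHomogeneous 1) (hgC : ∀ m, (gC m).IsHomogeneous 1)
    (hli : LinearIndependent K (Sum.elim h gC)) :
    Ideal.span (Set.range (plane₂Gens κ h gC)) ⊔ Ideal.span (Set.range (plane₂Cofs κ gA Q P)) =
      Ideal.span (Set.range h ∪ Set.range gC) ⊔ jacobianIdeal (twoPlanesForm gA h gC Q P) := by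
  have hrange : Set.range (plane₂Gens κ h gC) = Set.range h ∪ Set.range gC := by
    rw [show plane₂Gens κ h gC = Sum.elim h gC ∘ κ.symm from rfl, κ.symm.surjective.range_comp,
      Set.Sum.elim_range]
  rw [span_sup_span_eq_span_sup_jacobianIdeal (plane₂Gens κ h gC) (plane₂Cofs κ gA Q P)
    (isHomogeneous_plane₂Gens κ hh hgC) (hli.comp κ.symm κ.symm.injective),
    sum_plane₂Gens_mul_plane₂Cofs, hrange]

/-- From the joint independence of `(g, h, g')`: `(g, g')` is independent. [folklore] -/
private theorem linearIndependent_elim_left {M : Type*} [AddCommGroup M] [Module K M] {α β γ : Type*}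
    {gA : α → M} {h : β → M} {gC : γ → M} (hli : LinearIndependent K (Sum.elim (Sum.elim gA h) gC)) :
    LinearIndependent K (Sum.elim gA gC) := by
  have e : Sum.elim gA gC = Sum.elim (Sum.elim gA h) gC ∘ Sum.map Sum.inl id := by
    funext s; rcases s with i | m <;> rfl
  rw [e]
  exact hli.comp _ (Sum.map_injective.mpr ⟨Sum.inl_injective, Function.injective_id⟩)

/-- From the joint independence of `(g, h, g')`: `(h, g')` is independent. [folklore] -/
private theorem linearIndependent_elim_right {M : Type*} [AddCommGroup M] [Module K M] {α β γ : Type*}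
    {gA : α → M} {h : β → M} {gC : γ → M} (hli : LinearIndependent K (Sum.elim (Sum.elim gA h) gC)) :
    LinearIndependent K (Sum.elim h gC) := by
  have e : Sum.elim h gC = Sum.elim (Sum.elim gA h) gC ∘ Sum.map Sum.inr id := by
    funext s; rcases s with j | m <;> rfl
  rw [e]
  exact hli.comp _ (Sum.map_injective.mpr ⟨Sum.inr_injective, Function.injective_id⟩)

section Main

variable {d : ℕ} (hd : 2 ≤ d) (u v : Fin (k + 1) → MvPolynomial (Fin (2 * k + 2)) K)
  (hu : ∀ i, (u i).IsHomogeneous 1) (hv : ∀ i, (v i).IsHomogeneous 1)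
  (hlu : LinearIndependent K u) (hlv : LinearIndependent K v)

include hd hu hv hlu hlv

/-- **The normal form for arbitrary equations, with the intrinsic ideals.** For two `k`-planes `Π₁ = V(u)`,
`Π₂ = V(v)` (any linearly independent linear equations) and any form `F ∈ S_d ∩ (u) ∩ (v)` with finite-
dimensional Jacobian ring, there are adapted equations `(g, g')`, `(h, g')` (`g'` = `r := dim(⟨u⟩ ∩ ⟨v⟩)` common
forms, `c + r = k + 1`), forms `Q_{ij}` (degree `d−2`), `P_m` (degree `d−1`) with `F = twoPlanesForm g h g' Q P`,
AND the tree's two presentation ideals are `I(Π₁) = (u) + J^F`, `I(Π₂) = (v) + J^F`.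
[cite: Kloosterman2025, §4 (p. 10), Remark 5.2, Example 3.5] -/
theorem exists_twoPlanesForm_eq_and_planes_eq {F : MvPolynomial (Fin (2 * k + 2)) K} (hF : F.IsHomogeneous d)
    (hFu : F ∈ Ideal.span (Set.range u)) (hFv : F ∈ Ideal.span (Set.range v)) :
    ∃ (c : ℕ) (κ : Fin c ⊕ Fin (finrank K ↥(Submodule.span K (Set.range u) ⊓ Submodule.span K (Set.range v))) ≃
        Fin (k + 1))
      (gA h : Fin c → MvPolynomial (Fin (2 * k + 2)) K)
      (gC : Fin (finrank K ↥(Submodule.span K (Set.range u) ⊓ Submodule.span K (Set.range v))) →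
        MvPolynomial (Fin (2 * k + 2)) K)
      (Q : Fin c → Fin c → MvPolynomial (Fin (2 * k + 2)) K)
      (P : Fin (finrank K ↥(Submodule.span K (Set.range u) ⊓ Submodule.span K (Set.range v))) →
        MvPolynomial (Fin (2 * k + 2)) K),
      (∀ i, (gA i).IsHomogeneous 1) ∧ (∀ j, (h j).IsHomogeneous 1) ∧ (∀ m, (gC m).IsHomogeneous 1) ∧
      LinearIndependent K (Sum.elim (Sum.elim gA h) gC) ∧
      (∀ i j, (Q i j).IsHomogeneous (d - 2)) ∧ (∀ m, (P m).IsHomogeneous (d - 1)) ∧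
      twoPlanesForm gA h gC Q P = F ∧
      Ideal.span (Set.range (plane₁Gens κ gA gC)) ⊔ Ideal.span (Set.range (plane₁Cofs κ h Q P)) =
        Ideal.span (Set.range u) ⊔ jacobianIdeal F ∧
      Ideal.span (Set.range (plane₂Gens κ h gC)) ⊔ Ideal.span (Set.range (plane₂Cofs κ gA Q P)) =
        Ideal.span (Set.range v) ⊔ jacobianIdeal F := by
  obtain ⟨c, gA, h, gC, hgA, hh, hgC, hli, hu', hv', hcr⟩ := exists_adapted_linearForms u v hu hv hlu hlv
  rw [Fintype.card_fin] at hcr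
  let κ : Fin c ⊕ Fin (finrank K ↥(Submodule.span K (Set.range u) ⊓ Submodule.span K (Set.range v))) ≃
      Fin (k + 1) := finSumFinEquiv.trans (finCongr hcr)
  have hFu' : F ∈ Ideal.span (Set.range gA ∪ Set.range gC) := hu' ▸ hFu
  have hFv' : F ∈ Ideal.span (Set.range h ∪ Set.range gC) := hv' ▸ hFv
  obtain ⟨Q, P, hQ, hP, hFQP⟩ := exists_twoPlanesForm_eq_of_mem hd gA h gC hgA hh hgC hli hF hFu' hFv'
  refine ⟨c, κ, gA, h, gC, Q, P, hgA, hh, hgC, hli, hQ, hP, hFQP, ?_, ?_⟩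
  · rw [planes₁_eq_span_sup_jacobianIdeal κ gA h gC Q P hgA hgC (linearIndependent_elim_left hli), hFQP, hu']
  · rw [planes₂_eq_span_sup_jacobianIdeal κ gA h gC Q P hh hgC (linearIndependent_elim_right hli), hFQP, hv']

variable {F : MvPolynomial (Fin (2 * k + 2)) K} (hF : F.IsHomogeneous d)
  (hFu : F ∈ Ideal.span (Set.range u)) (hFv : F ∈ Ideal.span (Set.range v)) {N : ℕ} (hN : 0 < N)
  (hXN : ∀ j, (X j : MvPolynomial (Fin (2 * k + 2)) K) ^ N ∈ jacobianIdeal F)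

include hF hFu hFv hXN

/-- **`h_{I(Π₁)+I(Π₂)}(t) = ciHilbert((d−1)^r)(t)`, `r = dim(⟨u⟩ ∩ ⟨v⟩)`** (proof of Prop. 3.9: "The ideal
`I₁+I₂` is a complete intersection ideal with `k+c+1` generators of degree `1` and `k−c+1` generators of degree
`d−1`"; Example 3.16: "In particular `h_{I₁+I₂}(t) = 0` for `t > (k+1−c)(d−2)`") — for the intrinsic ideals
`I(Π₁) = (u) + J^F`, `I(Π₂) = (v) + J^F` of two `k`-planes in ARBITRARY position inside ANY hypersurface
`X = V(F)` with finite-dimensional Jacobian ring, in every degree `t`. [cite: Kloosterman2025, Proposition 3.9 (proof), Example 3.16] -/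
theorem hilbert_planeIdeals_sup_eq_ciHilbert (t : ℕ) :
    finrank K (homogeneousSubmodule (Fin (2 * k + 2)) K t) -
        finrank K (idealDegree ((Ideal.span (Set.range u) ⊔ jacobianIdeal F) ⊔
          (Ideal.span (Set.range v) ⊔ jacobianIdeal F)) t) =
      ciHilbert (List.replicate
        (finrank K ↥(Submodule.span K (Set.range u) ⊓ Submodule.span K (Set.range v))) (d - 1)) t := by
  obtain ⟨c, κ, gA, h, gC, Q, P, hgA, hh, hgC, hli, hQ, hP, hFQP, h₁, h₂⟩ :=
    exists_twoPlanesForm_eq_and_planes_eq hd u v hu hv hlu hlv hF hFu hFv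
  subst hFQP
  obtain ⟨-, -, hXs⟩ := X_pow_mem_planes κ gA h gC Q P hXN
  rw [← h₁, ← h₂, planes_sup_eq_span]
  exact hilbert_span_twoPlanes_eq_ciHilbert hd κ gA h gC P hgA hh hgC hP hXs t

/-- The same for the three-term sum `(u) + (v) + J^F` (`= I(Π₁) + I(Π₂)`). [cite: Kloosterman2025, Proposition 3.9 (proof)] -/
theorem hilbert_span_sup_span_sup_jacobianIdeal_eq_ciHilbert (t : ℕ) :
    finrank K (homogeneousSubmodule (Fin (2 * k + 2)) K t) -
        finrank K (idealDegree (Ideal.span (Set.range u) ⊔ Ideal.span (Set.range v) ⊔ jacobianIdeal F) t) =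
      ciHilbert (List.replicate
        (finrank K ↥(Submodule.span K (Set.range u) ⊓ Submodule.span K (Set.range v))) (d - 1)) t := by
  have hI : (Ideal.span (Set.range u) ⊔ jacobianIdeal F) ⊔ (Ideal.span (Set.range v) ⊔ jacobianIdeal F) =
      Ideal.span (Set.range u) ⊔ Ideal.span (Set.range v) ⊔ jacobianIdeal F :=
    le_antisymm
      (sup_le (sup_le (le_sup_left.trans le_sup_left) le_sup_right)
        (sup_le (le_sup_right.trans le_sup_left) le_sup_right))
      (sup_le (sup_le (le_sup_left.trans le_sup_left) (le_sup_left.trans le_sup_right))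
        (le_sup_right.trans le_sup_left))
  rw [← hI]
  exact hilbert_planeIdeals_sup_eq_ciHilbert hd u v hu hv hlu hlv hF hFu hFv hXN t

/-- **Proposition 3.9 in every degree, for every pair of `k`-planes at every hypersurface of the locus:
`h_{I(Π₁)∩I(Π₂)}(t) + ciHilbert((d−1)^r)(t) = 2·ciHilbert((d−1)^{k+1})(t)`** (`r = dim(⟨u⟩ ∩ ⟨v⟩) = k + 1 − c`),
for the intrinsic ideals `I(Π_j) = I_{Π_j}·S + J^F` — "The tangent space of `NL(Π₁,Π₂)` has codimension
`h_{I₁∩I₂}(d) = h_{I₁}(d) + h_{I₂}(d) − h_{I₁+I₂}(d)`" with both complete-intersection Hilbert functions, here in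
all degrees `t` and for planes given by arbitrary equations `u`, `v`. [cite: Kloosterman2025, Proposition 3.9 (proof), Lemma 2.3] -/
theorem hilbert_planeIdeals_inf_add_ciHilbert (t : ℕ) :
    (finrank K (homogeneousSubmodule (Fin (2 * k + 2)) K t) -
        finrank K (idealDegree ((Ideal.span (Set.range u) ⊔ jacobianIdeal F) ⊓
          (Ideal.span (Set.range v) ⊔ jacobianIdeal F)) t)) +
      ciHilbert (List.replicate
        (finrank K ↥(Submodule.span K (Set.range u) ⊓ Submodule.span K (Set.range v))) (d - 1)) t =
      2 * ciHilbert (List.replicate (k + 1) (d - 1)) t := by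
  obtain ⟨c, κ, gA, h, gC, Q, P, hgA, hh, hgC, hli, hQ, hP, hFQP, h₁, h₂⟩ :=
    exists_twoPlanesForm_eq_and_planes_eq hd u v hu hv hlu hlv hF hFu hFv
  subst hFQP
  rw [← h₁, ← h₂]
  exact twoPlanes_hilbert_inf_add_ciHilbert hd κ gA h gC Q P hgA hh hgC hQ hP hXN t

/-- At `t = d`, in Movasati's notation: **`codim_{S_d}(I(Π₁) ∩ I(Π₂))_d = intdim^d_{2k}(r)`** for every pair
of `k`-planes `Π₁ = V(u)`, `Π₂ = V(v)` with `r = dim(⟨u⟩ ∩ ⟨v⟩)` independent common equations, at every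
hypersurface `V(F) ⊇ Π₁ ∪ Π₂` with finite-dimensional Jacobian ring (Prop. 3.9: the tangent codimension of
`NL(Π₁,Π₂)` is the same at every point; [cite: Movasati2016Periods, Thm. 13] computes it at the Fermat point).
[cite: Kloosterman2025, Proposition 3.9] -/
theorem hilbert_planeIdeals_inf_eq_intdim :
    ((finrank K (homogeneousSubmodule (Fin (2 * k + 2)) K d) -
        finrank K (idealDegree ((Ideal.span (Set.range u) ⊔ jacobianIdeal F) ⊓
          (Ideal.span (Set.range v) ⊔ jacobianIdeal F)) d) : ℕ) : ℤ) =
      intdim (2 * k) d (finrank K ↥(Submodule.span K (Set.range u) ⊓ Submodule.span K (Set.range v))) := by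
  obtain ⟨c, κ, gA, h, gC, Q, P, hgA, hh, hgC, hli, hQ, hP, hFQP, h₁, h₂⟩ :=
    exists_twoPlanesForm_eq_and_planes_eq hd u v hu hv hlu hlv hF hFu hFv
  subst hFQP
  rw [← h₁, ← h₂]
  exact twoPlanes_hilbert_inf_eq_intdim hd κ gA h gC Q P hgA hh hgC hQ hP hXN

omit hd hu hv hlv hF hFu hFv hXN in
/-- `r = dim(⟨u⟩ ∩ ⟨v⟩) ≤ k + 1`. [folklore] -/
private theorem finrank_span_inf_span_le :
    finrank K ↥(Submodule.span K (Set.range u) ⊓ Submodule.span K (Set.range v)) ≤ k + 1 := by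
  haveI := FiniteDimensional.span_of_finite K (Set.finite_range u)
  calc finrank K ↥(Submodule.span K (Set.range u) ⊓ Submodule.span K (Set.range v))
      ≤ finrank K ↥(Submodule.span K (Set.range u)) := Submodule.finrank_mono inf_le_left
    _ = k + 1 := by rw [finrank_span_eq_card hlu, Fintype.card_fin]

/-! ## §4. The common image `(J^F : I(Π₁) + I(Π₂))` — Gorenstein duality in `R = S/J^F` -/

omit hd hlu hlv hFu hFv hXN in
/-- `I(Π₁) + I(Π₂)` is homogeneous and contains `J^F`. [cite: Kloosterman2025, Construction 3.1] -/
theorem isHomogeneous_planeIdeals_sup :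
    ((Ideal.span (Set.range u) ⊔ jacobianIdeal F) ⊔ (Ideal.span (Set.range v) ⊔ jacobianIdeal F)).IsHomogeneous
        (homogeneousSubmodule (Fin (2 * k + 2)) K) ∧
      jacobianIdeal F ≤ (Ideal.span (Set.range u) ⊔ jacobianIdeal F) ⊔ (Ideal.span (Set.range v) ⊔ jacobianIdeal F) :=
  ⟨(isHomogeneous_span_sup_jacobianIdeal u hu hF).sup (isHomogeneous_span_sup_jacobianIdeal v hv hF),
    le_sup_right.trans le_sup_left⟩

include hN in
/-- **Macaulay duality for the common image: `dim (J^F : I(Π₁)+I(Π₂))_b − dim J^F_b = ciHilbert((d−1)^r)(a)`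
for `a + b = (2k+2)(d−2)`** (the socle degree of the Jacobian ring). In `R = S/J^F` the ideal
`(J^F : I(Π₁)+I(Π₂))/J^F = Ann_R(Ī₁ + Ī₂)` is the intersection `D₁R ∩ D₂R` of the two principal ideals of the
classes (`span_det_sup_inf_span_det_sup_eq_colon`), and `dim Ann_R(Ī)_b = dim (R/Ī)_a` (tree
`finrank_idealDegree_colon_annIdeal_sub`, Meyer–Smith I.1.1 / Bruns–Herzog 3.2.12) with §3's `h_{I₁+I₂} = h_r`.
[cite: Kloosterman2025, Proposition 3.9 (proof), Lemma 2.9 (proof)] [cite: MeyerSmith2005, Lemma I.1.1]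
[cite: BrunsHerzog1998, Proposition 3.2.12 (b)] -/
theorem finrank_colon_planeIdeals_sup_sub {a b : ℕ} (hab : a + b = (2 * k + 2) * (d - 2)) :
    finrank K (idealDegree ((jacobianIdeal F).colon
        (((Ideal.span (Set.range u) ⊔ jacobianIdeal F) ⊔ (Ideal.span (Set.range v) ⊔ jacobianIdeal F) :
          Ideal (MvPolynomial (Fin (2 * k + 2)) K)) : Set (MvPolynomial (Fin (2 * k + 2)) K))) b) -
        finrank K (idealDegree (jacobianIdeal F) b) =
      ciHilbert (List.replicate
        (finrank K ↥(Submodule.span K (Set.range u) ⊓ Submodule.span K (Set.range v))) (d - 1)) a := by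
  obtain ⟨ℓ, hℓ, -, hJ⟩ := exists_annIdeal_eq_jacobianIdeal (N₀ := 2 * k + 1) hF hd hN hXN
  obtain ⟨hhom, hJI⟩ := isHomogeneous_planeIdeals_sup u v hu hv hF
  have hJI' : annIdeal ℓ ≤
      (Ideal.span (Set.range u) ⊔ jacobianIdeal F) ⊔ (Ideal.span (Set.range v) ⊔ jacobianIdeal F) :=
    hJ.le.trans hJI
  have h := finrank_idealDegree_colon_annIdeal_sub hℓ hhom hJI' hab
  rw [hJ] at h
  rw [h]
  exact hilbert_planeIdeals_sup_eq_ciHilbert hd u v hu hv hlu hlv hF hFu hFv hXN a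

include hN in
/-- **The window form**: for `(2k+2−r)(d−2) ≤ b ≤ (2k+2)(d−2)`,
`dim (J^F : I(Π₁)+I(Π₂))_b − dim J^F_b = ciHilbert((d−1)^r)(b − (2k+2−r)(d−2))` (Gorenstein symmetry of the
complete-intersection Hilbert function `ciHilbert((d−1)^r)`, socle degree `r(d−2)`). In the census record's
notation (`k` there = `k+1` pairs, `m+1 = r`, `s = b = t + (k+1)(d−2)`): `dim J_s = h_{m+1}(t − c′(d−2))`,
`c′ = k − m`, THEOREM 1 (iii). [cite: Kloosterman2025, Proposition 3.9 (proof), Example 3.16] -/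
theorem finrank_colon_planeIdeals_sup_sub_eq_window {b : ℕ}
    (hb₁ : (2 * k + 2 - finrank K ↥(Submodule.span K (Set.range u) ⊓ Submodule.span K (Set.range v))) *
      (d - 2) ≤ b) (hb₂ : b ≤ (2 * k + 2) * (d - 2)) :
    finrank K (idealDegree ((jacobianIdeal F).colon
        (((Ideal.span (Set.range u) ⊔ jacobianIdeal F) ⊔ (Ideal.span (Set.range v) ⊔ jacobianIdeal F) :
          Ideal (MvPolynomial (Fin (2 * k + 2)) K)) : Set (MvPolynomial (Fin (2 * k + 2)) K))) b) -
        finrank K (idealDegree (jacobianIdeal F) b) =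
      ciHilbert (List.replicate
        (finrank K ↥(Submodule.span K (Set.range u) ⊓ Submodule.span K (Set.range v))) (d - 1))
        (b - (2 * k + 2 - finrank K ↥(Submodule.span K (Set.range u) ⊓ Submodule.span K (Set.range v))) *
          (d - 2)) := by
  set r := finrank K ↥(Submodule.span K (Set.range u) ⊓ Submodule.span K (Set.range v)) with hr
  have hrk : r ≤ k + 1 := finrank_span_inf_span_le u v hlu
  have hab : ((2 * k + 2) * (d - 2) - b) + b = (2 * k + 2) * (d - 2) := by omega
  rw [finrank_colon_planeIdeals_sup_sub hd u v hu hv hlu hlv hF hFu hFv hN hXN hab, ← List.ofFn_const]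
  refine ciHilbert_ofFn_symm (fun _ : Fin r => d - 1) (fun _ => by omega) ?_
  simp only [Finset.sum_const, Finset.card_univ, Fintype.card_fin, smul_eq_mul]
  have h1 : (2 * k + 2 - r) * (d - 2) + r * (d - 2) = (2 * k + 2) * (d - 2) := by
    rw [← Nat.add_mul]; congr 1; omega
  rw [show d - 1 - 1 = d - 2 by omega]
  omega

include hN in
/-- … and **below the window the common image is `J^F` itself**: for `b < (2k+2−r)(d−2)`,
`dim (J^F : I(Π₁)+I(Π₂))_b = dim J^F_b` (the dual degree `a = (2k+2)(d−2) − b` exceeds the socle degree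
`r(d−2)` of `S/(I(Π₁)+I(Π₂))`: "`h_{I₁+I₂}(t) = 0` for `t > (k+1−c)(d−2)`", Example 3.16).
[cite: Kloosterman2025, Example 3.16] -/
theorem finrank_colon_planeIdeals_sup_sub_eq_zero_of_lt {b : ℕ}
    (hb : b < (2 * k + 2 - finrank K ↥(Submodule.span K (Set.range u) ⊓ Submodule.span K (Set.range v))) *
      (d - 2)) :
    finrank K (idealDegree ((jacobianIdeal F).colon
        (((Ideal.span (Set.range u) ⊔ jacobianIdeal F) ⊔ (Ideal.span (Set.range v) ⊔ jacobianIdeal F) :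
          Ideal (MvPolynomial (Fin (2 * k + 2)) K)) : Set (MvPolynomial (Fin (2 * k + 2)) K))) b) -
        finrank K (idealDegree (jacobianIdeal F) b) = 0 := by
  set r := finrank K ↥(Submodule.span K (Set.range u) ⊓ Submodule.span K (Set.range v)) with hr
  have hrk : r ≤ k + 1 := finrank_span_inf_span_le u v hlu
  have hle : (2 * k + 2 - r) * (d - 2) ≤ (2 * k + 2) * (d - 2) := Nat.mul_le_mul_right _ (by omega)
  have hab : ((2 * k + 2) * (d - 2) - b) + b = (2 * k + 2) * (d - 2) := by omega
  rw [finrank_colon_planeIdeals_sup_sub hd u v hu hv hlu hlv hF hFu hFv hN hXN hab, ← List.ofFn_const]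
  have h1 : (2 * k + 2 - r) * (d - 2) + r * (d - 2) = (2 * k + 2) * (d - 2) := by
    rw [← Nat.add_mul]; congr 1; omega
  have hpos := ciHilbert_ofFn_pos_iff (fun _ : Fin r => d - 1) (fun _ => by omega)
    (t := (2 * k + 2) * (d - 2) - b)
  simp only [Finset.sum_const, Finset.card_univ, Fintype.card_fin, smul_eq_mul] at hpos
  have hnot : ¬ ((2 * k + 2) * (d - 2) - b ≤ r * (d - 1 - 1)) := by
    rw [show d - 1 - 1 = d - 2 by omega]; omega
  exact Nat.eq_zero_of_not_pos fun h0 => hnot (hpos.mp h0)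

end Main

/-- **The common image of the two classes is the annihilator of `I(Π₁) + I(Π₂)`**: for homogeneous
presentations `F = Σ u_i g_i = Σ v_i g'_i` along the two planes with transition determinants `D₁`, `D₂`
(the two classes in `R = S/J^F`), `(D₁R) ∩ (D₂R) = Ann_R(Ī₁ + Ī₂)`, i.e.
`((D₁) + J^F) ∩ ((D₂) + J^F) = (J^F : I(Π₁) + I(Π₂))` — §2's `(J^F : I(Π_j)) = (D_j) + J^F` and
`(J : I₁ + I₂) = (J : I₁) ∩ (J : I₂)`. In the census record: `J := om R ∩ om′ R = (0 :_R (I_P + I_P′)R)`,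
THEOREM 1 (iii). [cite: Kloosterman2025, Example 3.5, Lemma 2.9 (proof)] [cite: MeyerSmith2005, Lemma I.1.1] -/
theorem span_det_sup_inf_span_det_sup_eq_colon {d : ℕ} (hd : 2 ≤ d)
    (u g v g' : Fin (k + 1) → MvPolynomial (Fin (2 * k + 2)) K)
    (hu : ∀ i, (u i).IsHomogeneous 1) (hv : ∀ i, (v i).IsHomogeneous 1)
    (hlu : LinearIndependent K u) (hlv : LinearIndependent K v)
    (hg : ∀ i, (g i).IsHomogeneous (d - 1)) (hg' : ∀ i, (g' i).IsHomogeneous (d - 1))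
    (hFF : ∑ i, v i * g' i = ∑ i, u i * g i) {N : ℕ} (hN : 0 < N)
    (hXN : ∀ j, (X j : MvPolynomial (Fin (2 * k + 2)) K) ^ N ∈ jacobianIdeal (∑ i, u i * g i)) :
    (Ideal.span {(ciTransitionMatrix u g).det} ⊔ jacobianIdeal (∑ i, u i * g i)) ⊓
        (Ideal.span {(ciTransitionMatrix v g').det} ⊔ jacobianIdeal (∑ i, u i * g i)) =
      (jacobianIdeal (∑ i, u i * g i)).colon
        (((Ideal.span (Set.range u) ⊔ jacobianIdeal (∑ i, u i * g i)) ⊔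
            (Ideal.span (Set.range v) ⊔ jacobianIdeal (∑ i, u i * g i)) :
          Ideal (MvPolynomial (Fin (2 * k + 2)) K)) : Set (MvPolynomial (Fin (2 * k + 2)) K)) := by
  have hXN' : ∀ j, (X j : MvPolynomial (Fin (2 * k + 2)) K) ^ N ∈ jacobianIdeal (∑ i, v i * g' i) := by
    rw [hFF]; exact hXN
  have h2 := jacobianIdeal_colon_span_sup_jacobianIdeal_eq hd v g' hv hlv hg' hN hXN'
  rw [hFF] at h2
  rw [colon_sup, jacobianIdeal_colon_span_sup_jacobianIdeal_eq hd u g hu hlu hg hN hXN, h2]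

section Finite

variable {d : ℕ} (hd : 2 ≤ d) (u v : Fin (k + 1) → MvPolynomial (Fin (2 * k + 2)) K)
  (hu : ∀ i, (u i).IsHomogeneous 1) (hv : ∀ i, (v i).IsHomogeneous 1)
  (hlu : LinearIndependent K u) (hlv : LinearIndependent K v)
  {F : MvPolynomial (Fin (2 * k + 2)) K} (hF : F.IsHomogeneous d)
  (hFu : F ∈ Ideal.span (Set.range u)) (hFv : F ∈ Ideal.span (Set.range v))

include hd hu hv hlu hlv hF hFu hFv

/-- `hilbert_planeIdeals_inf_add_ciHilbert` with the hypothesis `Module.Finite K (S ⧸ J^F)` (finite-dimensional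
Jacobian ring, every smooth hypersurface) in place of explicit powers of the variables: Prop. 3.9's count in
every degree for every pair of `k`-planes on every smooth `X`. [cite: Kloosterman2025, Proposition 3.9] -/
theorem hilbert_planeIdeals_inf_add_ciHilbert_of_finite
    [Module.Finite K (MvPolynomial (Fin (2 * k + 2)) K ⧸ jacobianIdeal F)] (t : ℕ) :
    (finrank K (homogeneousSubmodule (Fin (2 * k + 2)) K t) -
        finrank K (idealDegree ((Ideal.span (Set.range u) ⊔ jacobianIdeal F) ⊓
          (Ideal.span (Set.range v) ⊔ jacobianIdeal F)) t)) +
      ciHilbert (List.replicate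
        (finrank K ↥(Submodule.span K (Set.range u) ⊓ Submodule.span K (Set.range v))) (d - 1)) t =
      2 * ciHilbert (List.replicate (k + 1) (d - 1)) t := by
  obtain ⟨N, -, hXN⟩ := exists_forall_X_pow_mem_jacobianIdeal_of_finite (N₀ := 2 * k + 1) hF
  exact hilbert_planeIdeals_inf_add_ciHilbert hd u v hu hv hlu hlv hF hFu hFv hXN t

/-- `finrank_colon_planeIdeals_sup_sub` with the hypothesis `Module.Finite K (S ⧸ J^F)`.
[cite: Kloosterman2025, Proposition 3.9 (proof)] [cite: MeyerSmith2005, Lemma I.1.1] -/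
theorem finrank_colon_planeIdeals_sup_sub_of_finite
    [Module.Finite K (MvPolynomial (Fin (2 * k + 2)) K ⧸ jacobianIdeal F)] {a b : ℕ}
    (hab : a + b = (2 * k + 2) * (d - 2)) :
    finrank K (idealDegree ((jacobianIdeal F).colon
        (((Ideal.span (Set.range u) ⊔ jacobianIdeal F) ⊔ (Ideal.span (Set.range v) ⊔ jacobianIdeal F) :
          Ideal (MvPolynomial (Fin (2 * k + 2)) K)) : Set (MvPolynomial (Fin (2 * k + 2)) K))) b) -
        finrank K (idealDegree (jacobianIdeal F) b) =
      ciHilbert (List.replicate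
        (finrank K ↥(Submodule.span K (Set.range u) ⊓ Submodule.span K (Set.range v))) (d - 1)) a := by
  obtain ⟨N, hN, hXN⟩ := exists_forall_X_pow_mem_jacobianIdeal_of_finite (N₀ := 2 * k + 1) hF
  exact finrank_colon_planeIdeals_sup_sub hd u v hu hv hlu hlv hF hFu hFv hN hXN hab

end Finite

end TwoPlanes




end Literature.AlgebraicGeometry.Kloosterman2025
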